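import Mathlib
import Summits.Ventures.HodgeRepro2.T5InertHeckeCommutative
import Summits.Ventures.HodgeRepro2.T5HeckeIsomorphismTransportCells
import Summits.Ventures.HodgeRepro2.T5HeckeBasisCells

/-!
# `H(U(V_v), K_v) ≅ H(U(antidiag(1,u₀,1)), K_U)` with `T_g ↦ T_{P g P⁻¹}`: the cell basis of the
record's Hecke algebra

Blind cell `pub-hodge-repro2`, seat p8 (gen 13), Tier-5 kernel support.  `T5InertHeckeCommutative`
(T5-143) transports commutativity from the package's `(U(antidiag(1, u₀, 1)), K_U)` to the record's
`(U(H), K_H)`; this file records the transport itself — the algebra isomorphism and what it does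
to the double-coset operators — and the cell basis of the record's Hecke algebra:

* `exists_algEquiv_doubleCosetOp_of_isotropic_of_unramified` — **`∃ u₀ ∈ 𝒪_{F_v}^×`,
  `P ∈ GL₃(𝒪_{E_v})` with `Pᴴ H P = antidiag(1, u₀, 1)`, and `ε : H(U(antidiag), K_U) ≃ₐ[k] H(U(H), K_H)`
  with `ε(T_g) = T_{g'}` whenever `g' = P g P⁻¹`** (the composition of the transport along
  `U(antidiag) = U(Pᴴ H P)` and along the conjugation `U(Pᴴ H P) ≃* U(H)`, T5-142 / T5-144);
* `exists_basis_of_isotropic_of_unramified` — **`H(U(H), K_H)` has a basis `{ε(T_k)}_{k ∈ ℕ}`**,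
  the image of the cell basis `T5HeckeBasisCells.heckeBasisCells` (`T_k = 𝟙_{K_U a_k K_U}`,
  `a_k = diag(ϖ^k, 1, ϖ^{-k})`) — the vector-space half of the Satake isomorphism for the record's
  own `K_v`.

README §8(d): uses an L-value-free non-vanishing device: NO.
-/

namespace Summit.Ventures.HodgeRepro2.T5InertHeckeCells

open IsLocalRing IsLocalization Matrix T5UnitaryGroupIsometry T5IntegralUnits
  T5HeckeIsomorphismTransport T5HeckeIsomorphismTransportCells

variable (R₀ F E : Type*) [CommRing R₀] [IsDomain R₀] [IsDiscreteValuationRing R₀] [Field F]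
  [Field E] [Algebra R₀ F] [IsFractionRing R₀ F] [Algebra F E] [Algebra R₀ E]
  [IsScalarTower R₀ F E] [FiniteDimensional F E] [Algebra.IsSeparable F E]
  [IsLocalRing (integralClosure R₀ E)] [Finite (ResidueField R₀)]

include F in
/-- **The transport `H(U(antidiag(1, u₀, 1)), K_U) ≃ₐ[k] H(U(H), K_H)`, `T_g ↦ T_{P g P⁻¹}`**, for
the record's `H` (hermitian for the Galois star, entries and inverse in `𝒪_E`, isotropic) at an
unramified place. -/
theorem exists_algEquiv_doubleCosetOp_of_isotropic_of_unramified (h2 : Module.finrank F E = 2)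
    (σ : E ≃ₐ[F] E) (hσ : σ ≠ 1)
    (hunr : (maximalIdeal R₀).map (algebraMap R₀ (integralClosure R₀ E)) =
      maximalIdeal (integralClosure R₀ E)) (H : Matrix (Fin 3) (Fin 3) E) (k : Type*) [Field k] :
    letI := T5StarOfInvolution.starRingOfQuadratic h2 σ hσ
    H.IsHermitian → (∀ i j, IsInteger (integralClosure R₀ E) (H i j)) → IsUnit H.det →
      (∀ i j, IsInteger (integralClosure R₀ E) (H⁻¹ i j)) →
      ∀ v : Fin 3 → E, v ≠ 0 → sesqForm H v v = 0 →
      ∃ (u₀ : R₀ˣ) (P : GL (Fin 3) E),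
        P ∈ (Matrix.GeneralLinearGroup.map (algebraMap (integralClosure R₀ E) E)).range ∧
        (P : Matrix (Fin 3) (Fin 3) E)ᴴ * H * (P : Matrix (Fin 3) (Fin 3) E) =
          T5HermitianThreeElements.J3 (algebraMap R₀ E (u₀ : R₀)) ∧
        ∃ ε : T5HeckePermutationModule.heckeAlgebra k (T5UnitaryHeckeAdjoint.hyperspecialSubgroup
            (integralClosure R₀ E) (T5HermitianThreeElements.J3 (algebraMap R₀ E (u₀ : R₀)))) ≃ₐ[k]
          T5HeckePermutationModule.heckeAlgebra k
            (T5UnitaryHeckeAdjoint.hyperspecialSubgroup (integralClosure R₀ E) H),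
          ∀ (g : T5UnitaryGroupForm.formUnitaryGroup
              (T5HermitianThreeElements.J3 (algebraMap R₀ E (u₀ : R₀))))
            (g' : T5UnitaryGroupForm.formUnitaryGroup H),
            (g' : GL (Fin 3) E) = P * (g : GL (Fin 3) E) * P⁻¹ →
            ∀ [Finite (MulAction.orbit (T5UnitaryHeckeAdjoint.hyperspecialSubgroup
                (integralClosure R₀ E) (T5HermitianThreeElements.J3 (algebraMap R₀ E (u₀ : R₀))))
                (g : _ ⧸ T5UnitaryHeckeAdjoint.hyperspecialSubgroup (integralClosure R₀ E)
                  (T5HermitianThreeElements.J3 (algebraMap R₀ E (u₀ : R₀)))))]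
              [Finite (MulAction.orbit
                (T5UnitaryHeckeAdjoint.hyperspecialSubgroup (integralClosure R₀ E) H)
                (g' : _ ⧸ T5UnitaryHeckeAdjoint.hyperspecialSubgroup (integralClosure R₀ E) H))],
            ε (T5HeckeDoubleCoset.doubleCosetOp k _ g) =
              T5HeckeDoubleCoset.doubleCosetOp k _ g' := by
  letI := T5StarOfInvolution.starRingOfQuadratic h2 σ hσ
  intro hH hHint hHdet hHinv v hv hv0
  obtain ⟨P, hP, hPdet, u₀, hPHP⟩ :=
    T5InertLatticeNormalForm.exists_congruent_J3_integral_of_isotropic_of_unramified' R₀ F E h2 σ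
      hσ hunr H hH hHint hHdet hHinv v hv hv0
  haveI : IsFractionRing (integralClosure R₀ E) E :=
    integralClosure.isFractionRing_of_finite_extension F E
  set P' : GL (Fin 3) E := Matrix.GeneralLinearGroup.mk'' P (isUnit_iff_ne_zero.mpr hPdet.2.1)
  have hP' : P' ∈ (Matrix.GeneralLinearGroup.map (algebraMap (integralClosure R₀ E) E)).range :=
    T5InertHeckeCommutative.mem_range_of_isInteger_of_isRUnit_det hP hPdet
  have hPHP' : (P' : Matrix (Fin 3) (Fin 3) E)ᴴ * H * (P' : Matrix (Fin 3) (Fin 3) E) =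
      T5HermitianThreeElements.J3 (algebraMap R₀ E (u₀ : R₀)) := hPHP
  refine ⟨u₀, P', hP', hPHP', ?_⟩
  -- the two transports
  set φ₁ := MulEquiv.subgroupCongr (congrArg T5UnitaryGroupForm.formUnitaryGroup hPHP'.symm)
  have hK₁ : ∀ g, g ∈ T5UnitaryHeckeAdjoint.hyperspecialSubgroup (integralClosure R₀ E)
      (T5HermitianThreeElements.J3 (algebraMap R₀ E (u₀ : R₀))) ↔
      φ₁ g ∈ T5UnitaryHeckeAdjoint.hyperspecialSubgroup (integralClosure R₀ E)
        ((P' : Matrix (Fin 3) (Fin 3) E)ᴴ * H * (P' : Matrix (Fin 3) (Fin 3) E)) := by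
    intro g
    rw [Subgroup.mem_subgroupOf, Subgroup.mem_subgroupOf, MulEquiv.subgroupCongr_apply]
  set φ₂ := T5HermitianIsotropicForm.formUnitaryGroupMulEquiv_conj H P'
  have hmap := T5HermitianIsotropicLattice.map_conj_hyperspecialSubgroup (R := integralClosure R₀ E)
    H P' hP'
  have hK₂ : ∀ g, g ∈ T5UnitaryHeckeAdjoint.hyperspecialSubgroup (integralClosure R₀ E)
      ((P' : Matrix (Fin 3) (Fin 3) E)ᴴ * H * (P' : Matrix (Fin 3) (Fin 3) E)) ↔
      φ₂ g ∈ T5UnitaryHeckeAdjoint.hyperspecialSubgroup (integralClosure R₀ E) H := by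
    intro g
    rw [← hmap]
    exact (Subgroup.mem_map_iff_mem φ₂.injective).symm
  refine ⟨(heckeAlgebraEquivOfMulEquiv k φ₁ hK₁).trans (heckeAlgebraEquivOfMulEquiv k φ₂ hK₂),
    fun g g' hg' => ?_⟩
  have hgg : φ₂ (φ₁ g) = g' := by
    apply Subtype.ext
    rw [hg', T5HermitianIsotropicLattice.coe_formUnitaryGroupMulEquiv_conj,
      MulEquiv.subgroupCongr_apply]
  subst hgg
  intro _ _
  haveI : Finite (MulAction.orbit (T5UnitaryHeckeAdjoint.hyperspecialSubgroup (integralClosure R₀ E)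
      ((P' : Matrix (Fin 3) (Fin 3) E)ᴴ * H * (P' : Matrix (Fin 3) (Fin 3) E))) ((φ₁ g : _) : _ ⧸ T5UnitaryHeckeAdjoint.hyperspecialSubgroup
        (integralClosure R₀ E) ((P' : Matrix (Fin 3) (Fin 3) E)ᴴ * H * (P' : Matrix (Fin 3) (Fin 3) E)))) := by
    rw [← quotientEquivOfMulEquiv_image_orbit φ₁ hK₁ g]
    exact ((Set.toFinite _).image _).to_subtype
  rw [AlgEquiv.trans_apply, heckeAlgebraEquivOfMulEquiv_doubleCosetOp,
    heckeAlgebraEquivOfMulEquiv_doubleCosetOp]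

include F in
/-- **The cell basis of the record's `H(U(H), K_H)`**: the image under `ε` of the basis
`{T_k}_{k ∈ ℕ}` of `H(U(antidiag(1, u₀, 1)), K_U)` (`T5HeckeBasisCells`), `ϖ` a uniformiser of `R₀`. -/
theorem exists_basis_of_isotropic_of_unramified (h2 : Module.finrank F E = 2) (σ : E ≃ₐ[F] E)
    (hσ : σ ≠ 1)
    (hunr : (maximalIdeal R₀).map (algebraMap R₀ (integralClosure R₀ E)) =
      maximalIdeal (integralClosure R₀ E)) {ϖ : R₀} (hϖ : Irreducible ϖ)
    (H : Matrix (Fin 3) (Fin 3) E) (k : Type*) [Field k] :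
    letI := T5StarOfInvolution.starRingOfQuadratic h2 σ hσ
    H.IsHermitian → (∀ i j, IsInteger (integralClosure R₀ E) (H i j)) → IsUnit H.det →
      (∀ i j, IsInteger (integralClosure R₀ E) (H⁻¹ i j)) →
      ∀ v : Fin 3 → E, v ≠ 0 → sesqForm H v v = 0 →
      ∃ (u₀ : R₀ˣ) (b : Module.Basis ℕ k (T5HeckePermutationModule.heckeAlgebra k
          (T5UnitaryHeckeAdjoint.hyperspecialSubgroup (integralClosure R₀ E) H)))
        (ε : T5HeckePermutationModule.heckeAlgebra k (T5UnitaryHeckeAdjoint.hyperspecialSubgroup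
            (integralClosure R₀ E) (T5HermitianThreeElements.J3 (algebraMap R₀ E (u₀ : R₀)))) ≃ₐ[k]
          T5HeckePermutationModule.heckeAlgebra k
            (T5UnitaryHeckeAdjoint.hyperspecialSubgroup (integralClosure R₀ E) H)),
        haveI := T5UnramifiedUniformiser.isDiscreteValuationRing_integralClosure R₀ F E
        haveI := T5ResidueFieldFinite.finite_residueField_integralClosure R₀ F E
        haveI : IsFractionRing (integralClosure R₀ E) E :=
          integralClosure.isFractionRing_of_finite_extension F E
        ∀ i : ℕ, b i = ε (T5HeckeBasisCells.heckeBasisCells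
          (fun x hx => T5StarOfInvolution.isInteger_integralClosure_star σ
            (T5QuadraticAutomorphism.apply_apply h2 σ hσ) x hx)
          (algebraMap R₀ E (u₀ : R₀)) (T5StarOfInvolution.star_algebraMap_base σ
            (T5QuadraticAutomorphism.apply_apply h2 σ hσ) (u₀ : R₀))
          (T5GaloisCartanThree.algebraMap_unit_ne_zero (F := F) u₀)
          (T5GaloisCartanThree.isInteger_algebraMap (u₀ : R₀))
          (T5GaloisCartanThree.isInteger_algebraMap_unit_inv u₀)
          (T5GaloisCartanThree.irreducible_uniformiser hunr hϖ)
          (T5StarOfInvolution.star_algebraMap_integralClosure σ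
            (T5QuadraticAutomorphism.apply_apply h2 σ hσ) ϖ) k i) := by
  letI := T5StarOfInvolution.starRingOfQuadratic h2 σ hσ
  intro hH hHint hHdet hHinv v hv hv0
  obtain ⟨u₀, P, -, -, ε, -⟩ := exists_algEquiv_doubleCosetOp_of_isotropic_of_unramified R₀ F E h2
    σ hσ hunr H k hH hHint hHdet hHinv v hv hv0
  haveI := T5UnramifiedUniformiser.isDiscreteValuationRing_integralClosure R₀ F E
  haveI := T5ResidueFieldFinite.finite_residueField_integralClosure R₀ F E
  haveI : IsFractionRing (integralClosure R₀ E) E :=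
    integralClosure.isFractionRing_of_finite_extension F E
  exact ⟨u₀, (T5HeckeBasisCells.heckeBasisCells _ _ _ _ _ _ _ _ k).map ε.toLinearEquiv, ε,
    fun i => Module.Basis.map_apply _ _ i⟩

end Summit.Ventures.HodgeRepro2.T5InertHeckeCells
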